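import Literature.NumberTheory.Automorphic.Liu2021.Thm418AsPrinted
import Mathlib.LinearAlgebra.DirectSum.Finsupp
import Mathlib.LinearAlgebra.FreeModule.Basic
import Mathlib.RepresentationTheory.Irreducible
import HarnessLib

/-!
# [Liu2021, Thm. 4.18]: non-zero `K`-invariants and non-zero `Hom_E(A_K, A_μ)_ℚ` at small level — bookkeeping consequences

Reproduction (Literature): kernel-checked consequences of the AS-PRINTED statement
`Literature.NumberTheory.Automorphic.Liu2021.Thm418AsPrinted` (the sibling file `Thm418AsPrinted.lean`) over its own
carriers `Thm418Data`; no new axioms, no records, nothing cited as a fact beyond what the sibling records.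

What a consumer of Thm. 4.18 on the SUPPLY side (Hodge/CM programme, transposition item (vi) S2: «`Hom(Alb(P_Γ), A_μ) ≠ 0`
at some small level») needs from the printed isomorphism `Ω(μ) ⊗_{M_μ} ℂ ≃ ⊕_{ε,χ} ω(μ,ε,χ)` and item (1)
`Ω(μ)^K ≃ Hom_E(A_K, A_μ)_ℚ` is exactly the passage

  «one summand `ω(μ,ε,χ)` has a NON-ZERO vector fixed by an open compact `K₁`»  ⟹  «`Ω(μ)^K ≠ 0`, hence
  `Hom_E(A_K, A_μ)_ℚ ≠ 0`, for every open compact `K ≤ K₁ ∩ K₀(D_μ)`»,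

where the only non-formal point is that `K`-invariants of `Ω(μ) ⊗_{M_μ} ℂ` come from `K`-invariants of `Ω(μ)`: `ℂ` is a
FREE `M_μ`-module, so `ℂ ⊗_{M_μ} Ω(μ) ≅ ⊕_{basis} Ω(μ)` as `K`-modules (`exists_fixed_ne_zero_of_lTensor_fixed`, linear
algebra over any field).  The hypothesis «non-zero smooth vector» is where [Liu2021] Def. 4.11 («`ω(μ,ε,χ)` … is an
irreducible admissible representation of `𝔾(𝔸_F^∞)`») and App. D Lem. D.1 (1) (the local factors are non-zero for
`n ≥ 3`) enter; it is NOT part of Thm. 4.18 and stays an explicit hypothesis here.  Non-emptiness of the index set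
(a `μ`-admissible `ε` exists) is the tree theorem `Liu2021.exists_isAdmissibleElement_of_cmType` (Def. 4.12, weak
approximation) plus one automorphic character `χ` (e.g. the trivial one) supplied by the consumer.

* `exists_fixed_ne_zero_of_lTensor_fixed` (private) — over a field `R`, a free (any) `R`-module `A` and a family of endomorphisms
  `f a` of `N`: a non-zero `x ∈ A ⊗_R N` fixed by every `1 ⊗ f a` yields a non-zero `n ∈ N` fixed by every `f a`.
* `Thm418Data.nonempty_admIndex` — the index set `{(ε,χ) : ε μ-admissible}` is inhabited as soon as `Chi` is.
* `Thm418Data.exists_mem_invariants_ne_zero` — Thm. 4.18 (main) + a non-zero `K`-fixed vector in one `ω(μ,ε,χ)` ⟹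
  `Ω(μ)^K ∋ ω ≠ 0`.
* `Thm418Data.exists_homK_ne_zero`, `Thm418Data.exists_homK_ne_zero_of_smooth`,
  `Thm418Data.exists_homK_ne_zero_of_irreducible_smooth` (hypotheses in Def. 4.11's words), `exists_level_homK_ne_zero`,
  `exists_homK_ne_zero_le` (level forced below a given open compact `K'`) —
  with item (1): for every object `D_μ ∈ 𝒜(μ)` there is an open compact `K₀` with `Hom_E(A_K, A_μ)_ℚ ∋ φ ≠ 0` for EVERY
  open compact `K ≤ K₀`.

* `Thm418Data.scalarDatum_consistent` — T5 CONSISTENCY CERTIFICATE: a datum at which every hypothesis used in this file holds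
  at once (no contradiction is derivable from any of the binder sets).

References (context only; every declaration below is proved): Y. Liu, *Fourier–Jacobi cycles and arithmetic relative
trace formula*, Camb. J. Math. 9 (2021) = arXiv:2102.11518, Def. 4.11, Def. 4.12, Def. 4.16, Thm. 4.18, Lem. D.1.
-/

noncomputable section

open NumberField TensorProduct DirectSum

namespace Literature.NumberTheory.Automorphic.Liu2021

/-! ## Linear algebra: invariants of `A ⊗_R N` along a free `A` come from invariants of `N` -/

/-- **Fixed vectors descend along a free base change.**  `R` a field, `A` an `R`-module (free, as every module over
a field), `N` an `R`-module, `f a : N →ₗ[R] N` a family of endomorphisms.  If `x ∈ A ⊗_R N` is non-zero and fixed by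
every `1 ⊗ f a`, then some non-zero `n ∈ N` is fixed by every `f a`: in coordinates along an `R`-basis of `A`,
`A ⊗_R N ≅ ⊕_{basis} N` compatibly with `1 ⊗ f a ↦ ⊕ f a` (`TensorProduct.finsuppScalarLeft`), and a non-zero
coordinate of `x` does it.  (Private helper.) [folklore] -/
private theorem exists_fixed_ne_zero_of_lTensor_fixed {R : Type*} [Field R] {A : Type*} [AddCommGroup A] [Module R A]
    {N : Type*} [AddCommGroup N] [Module R N] {ι : Sort*} (f : ι → (N →ₗ[R] N)) {x : A ⊗[R] N} (hx : x ≠ 0)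
    (hfix : ∀ a, (f a).lTensor A x = x) : ∃ n : N, n ≠ 0 ∧ ∀ a, f a n = n := by
  classical
  let b := Module.Free.chooseBasis R A
  let e : A ⊗[R] N ≃ₗ[R] (Module.Free.ChooseBasisIndex R A →₀ N) :=
    (TensorProduct.congr b.repr (LinearEquiv.refl R N)).trans
      (TensorProduct.finsuppScalarLeft R N (Module.Free.ChooseBasisIndex R A))
  -- `e` intertwines `1 ⊗ g` with the coordinatewise action of `g`
  have key : ∀ (g : N →ₗ[R] N) (y : A ⊗[R] N) (j : Module.Free.ChooseBasisIndex R A),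
      e (g.lTensor A y) j = g (e y j) := by
    intro g y j
    induction y using TensorProduct.induction_on with
    | zero => simp only [map_zero, Finsupp.coe_zero, Pi.zero_apply]
    | tmul a n =>
      simp only [e, LinearMap.lTensor_tmul, LinearEquiv.trans_apply, TensorProduct.congr_tmul,
        LinearEquiv.refl_apply, TensorProduct.finsuppScalarLeft_apply_tmul_apply, map_smul]
    | add y z hy hz => simp only [map_add, Finsupp.coe_add, Pi.add_apply, hy, hz]
  have hex : e x ≠ 0 := fun h0 => hx (e.map_eq_zero_iff.mp h0)
  obtain ⟨j, hj⟩ : ∃ j, e x j ≠ 0 := by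
    by_contra hcon
    push Not at hcon
    exact hex (Finsupp.ext fun j => by rw [hcon j, Finsupp.zero_apply])
  refine ⟨e x j, hj, fun a => ?_⟩
  rw [← key (f a) x j, hfix a]

namespace Thm418Data

variable {F E : Type} [Field F] [NumberField F] [IsTotallyReal F] [Field E] [NumberField E] [Algebra F E]
  [IsTotallyComplex E] [Algebra.IsQuadraticExtension F E] {D : Thm418Data F E}

/-- **The index set of Thm. 4.18 is inhabited**: a `μ`-admissible `ε` exists — take `ε := (e · Nm_{E_v/F_v} E_v^×)_v`
for an admissible element `e ∈ E^{×−}` of Def. 4.12, which exists for the CM type `Φ_μ` by weak approximation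
(`Liu2021.exists_isAdmissibleElement_of_cmType`) — and pair it with any automorphic character `χ` of `E¹ \ (𝔸_E^∞)¹`
(e.g. the trivial one; the carrier `Chi` is the consumer's). [cite: Liu2021, Def. 4.12] -/
theorem nonempty_admIndex (χ : D.Chi) : Nonempty D.AdmIndex := by
  haveI : IsCMField E := isCMField F E
  obtain ⟨e, he⟩ :=
    Literature.AlgebraicGeometry.Liu2021.exists_isAdmissibleElement_of_cmType D.cmType.1 D.cmType.2
  exact ⟨⟨(D.epsOf e, χ), e, he, rfl⟩⟩

/-- **Thm. 4.18 (main statement) ⟹ non-zero `K`-invariants of `Ω(μ)`.**  If one summand `ω(μ,ε,χ)` of the printed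
isomorphism `Φ : Ω(μ) ⊗_{M_μ} ℂ ≃ ⊕ ω(μ,ε,χ)` contains a non-zero vector `v` fixed by a subgroup `K ≤ 𝔾(𝔸_F^∞)`, then
`Ω(μ)^K` contains a non-zero element: `Φ⁻¹(v)` is a non-zero `K`-fixed element of `Ω(μ) ⊗_{M_μ} ℂ` (the isomorphism is
`ℂ[𝔾(𝔸_F^∞)]`-linear), and `K`-fixed vectors descend along the free base change `M_μ → ℂ`
(`exists_fixed_ne_zero_of_lTensor_fixed`).  Our bookkeeping; the input «`v ≠ 0` fixed by `K`» is Def. 4.11 /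
Lem. D.1 (1), not Thm. 4.18. [cite: Liu2021, Thm. 4.18] -/
theorem exists_mem_invariants_ne_zero (h : Liu2021.Thm418AsPrinted D) (i : D.AdmIndex) (K : Subgroup D.G)
    {v : D.omegaAt i} (hv : v ≠ 0) (hKv : ∀ k ∈ K, D.rhoAt i k v = v) :
    ∃ ω ∈ D.invariants K, ω ≠ 0 := by
  classical
  obtain ⟨Φ, hΦ, -, -, -⟩ := h
  -- the vector `v` placed in the `i`-th summand, and its preimage `x` under `Φ`
  set y : ⨁ j : D.AdmIndex, D.omegaAt j := DirectSum.of (fun j => D.omegaAt j) i v with hy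
  have hyi : y i = v := DirectSum.of_eq_same i v
  set x : ℂ ⊗[fieldOfValues E D.μ] D.Ω := Φ.symm y with hx
  have hΦx : Φ x = y := Φ.apply_symm_apply y
  have hx0 : x ≠ 0 := by
    intro h0
    apply hv
    rw [← hyi, ← hΦx, h0, map_zero, DirectSum.zero_apply]
  -- `x` is fixed by `K`: check after `Φ`, summand by summand
  have hfix : ∀ k ∈ K, (D.rhoΩ k).baseChange ℂ x = x := by
    intro k hk
    apply Φ.injective
    refine DFinsupp.ext fun j => ?_
    rw [hΦ k x j, hΦx]
    by_cases hji : j = i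
    · subst hji
      rw [hyi, hKv k hk]
    · rw [hy, DirectSum.of_eq_of_ne i j v hji, map_zero]
  -- descend the fixed vector from `ℂ ⊗ Ω(μ)` to `Ω(μ)`
  obtain ⟨ω, hω0, hω⟩ := exists_fixed_ne_zero_of_lTensor_fixed (A := ℂ) (fun k : K => D.rhoΩ (k : D.G)) hx0
    (fun k => (congrFun ((D.rhoΩ (k : D.G)).baseChange_eq_ltensor (A := ℂ)) x).symm.trans (hfix k k.2))
  exact ⟨ω, fun k hk => hω ⟨k, hk⟩, hω0⟩

/-- **Thm. 4.18 (main) + (1) ⟹ `Hom_E(A_K, A_μ)_ℚ ≠ 0` at every small level.**  Given an object `D_μ ∈ 𝒜(μ)`, a summand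
`ω(μ,ε,χ)` and a non-zero vector of it fixed by an open compact `K₁`: there is an open compact `K₀` (namely
`K₁ ∩ K₀(D_μ)`, with `K₀(D_μ)` the threshold of item (1)) such that for EVERY open compact `K ≤ K₀` the group
`Hom_E(A_K, A_μ)_ℚ` has a non-zero element — the preimage under the canonical map `res` (injective with image `Ω(μ)^K`
by item (1)) of a non-zero `K`-invariant (`exists_mem_invariants_ne_zero`).  Our bookkeeping. [cite: Liu2021, Thm. 4.18 (1)] -/
theorem exists_homK_ne_zero (h : Liu2021.Thm418AsPrinted D) (Dμ : D.Obj) (i : D.AdmIndex) {K₁ : Subgroup D.G}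
    (hK₁ : IsOpenCompact K₁) {v : D.omegaAt i} (hv : v ≠ 0) (hKv : ∀ k ∈ K₁, D.rhoAt i k v = v) :
    ∃ K₀ : Subgroup D.G, IsOpenCompact K₀ ∧
      ∀ K : Subgroup D.G, IsOpenCompact K → K ≤ K₀ → ∃ φ : D.HomK K Dμ, φ ≠ 0 := by
  have h' := h
  obtain ⟨-, -, h1, -, -⟩ := h'
  obtain ⟨K₂, hK₂, hres⟩ := h1 Dμ
  refine ⟨K₁ ⊓ K₂, ⟨?_, ?_⟩, fun K hK hle => ?_⟩
  · rw [Subgroup.coe_inf]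
    exact hK₁.1.inter hK₂.1
  · rw [Subgroup.coe_inf]
    exact hK₁.2.inter_right (Subgroup.isClosed_of_isOpen K₂ hK₂.1)
  · obtain ⟨ω, hωK, hω0⟩ := exists_mem_invariants_ne_zero h i K hv
      (fun k hk => hKv k (le_trans hle inf_le_left hk))
    obtain ⟨-, hrange⟩ := hres K hK (le_trans hle inf_le_right)
    obtain ⟨φ, hφ⟩ : ω ∈ Set.range (D.res K Dμ) := hrange ▸ hωK
    exact ⟨φ, fun h0 => hω0 (by rw [← hφ, h0, map_zero])⟩

/-- **Supply form for a consumer.**  Thm. 4.18 as printed, one object `D_μ ∈ 𝒜(μ)` (Prop. 4.6 (1): `𝒜(μ)` is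
non-empty — the consumer's), one automorphic character `χ` (the trivial one will do), and the smoothness/non-vanishing
of the oscillator representations (Def. 4.11 «irreducible admissible» with Lem. D.1 (1): every `ω(μ,ε,χ)` has a non-zero
vector fixed by some open compact subgroup) give an open compact `K₀ ≤ 𝔾(𝔸_F^∞)` with `Hom_E(A_K, A_μ)_ℚ ≠ 0` for every
open compact `K ≤ K₀` — i.e. `A_μ` MEETS the Albanese `A_K` of `X_K` at every sufficiently small level.  Our bookkeeping.
[cite: Liu2021, Thm. 4.18 (1)] -/
theorem exists_homK_ne_zero_of_smooth (h : Liu2021.Thm418AsPrinted D) (Dμ : D.Obj) (χ : D.Chi)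
    (hω : ∀ i : D.AdmIndex, ∃ K₁ : Subgroup D.G, IsOpenCompact K₁ ∧
      ∃ v : D.omegaAt i, v ≠ 0 ∧ ∀ k ∈ K₁, D.rhoAt i k v = v) :
    ∃ K₀ : Subgroup D.G, IsOpenCompact K₀ ∧
      ∀ K : Subgroup D.G, IsOpenCompact K → K ≤ K₀ → ∃ φ : D.HomK K Dμ, φ ≠ 0 := by
  obtain ⟨i⟩ := nonempty_admIndex (D := D) χ
  obtain ⟨K₁, hK₁, v, hv, hKv⟩ := hω i
  exact exists_homK_ne_zero h Dμ i hK₁ hv hKv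

/-- **The same from Def. 4.11's words «irreducible admissible».**  If every summand `ω(μ,ε,χ)` is IRREDUCIBLE (Mathlib's
`Representation.IsIrreducible`: the subrepresentation lattice is simple, so the space is non-trivial) and SMOOTH (every
vector is fixed by an open subgroup of `𝔾(𝔸_F^∞)`), then — with an object `D_μ` (whose item-(1) threshold supplies an
open compact subgroup to intersect with) and one automorphic character `χ` — `Hom_E(A_K, A_μ)_ℚ ≠ 0` for every open
compact `K` below some open compact `K₀`.  Our bookkeeping over Thm. 4.18 as printed. [cite: Liu2021, Def. 4.11 and Thm. 4.18 (1)] -/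
theorem exists_homK_ne_zero_of_irreducible_smooth (h : Liu2021.Thm418AsPrinted D) (Dμ : D.Obj) (χ : D.Chi)
    (hirr : ∀ i : D.AdmIndex, (D.rhoAt i).IsIrreducible)
    (hsm : ∀ (i : D.AdmIndex) (v : D.omegaAt i), ∃ S : Subgroup D.G, IsOpen (S : Set D.G) ∧
      ∀ k ∈ S, D.rhoAt i k v = v) :
    ∃ K₀ : Subgroup D.G, IsOpenCompact K₀ ∧
      ∀ K : Subgroup D.G, IsOpenCompact K → K ≤ K₀ → ∃ φ : D.HomK K Dμ, φ ≠ 0 := by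
  obtain ⟨i⟩ := nonempty_admIndex (D := D) χ
  haveI := hirr i
  -- irreducible ⇒ the carrier is non-trivial (`⊥ ≠ ⊤` among the subrepresentations)
  haveI : Nontrivial (D.omegaAt i) := by
    by_contra hV
    rw [not_nontrivial_iff_subsingleton] at hV
    exact (IsSimpleOrder.bot_ne_top (α := Subrepresentation (D.rhoAt i)))
      (Subrepresentation.toSubmodule_injective (Subsingleton.elim _ _))
  obtain ⟨v, hv⟩ := exists_ne (0 : D.omegaAt i)
  obtain ⟨S, hS, hSv⟩ := hsm i v
  have h' := h
  obtain ⟨-, -, h1, -, -⟩ := h'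
  obtain ⟨K₂, hK₂, -⟩ := h1 Dμ
  have hK₁ : IsOpenCompact (S ⊓ K₂) := by
    refine ⟨?_, ?_⟩ <;> rw [Subgroup.coe_inf]
    · exact hS.inter hK₂.1
    · exact hK₂.2.inter_left (Subgroup.isClosed_of_isOpen S hS)
  exact exists_homK_ne_zero h Dμ i hK₁ hv (fun k hk => hSv k (inf_le_left (a := S) hk))

/-- The same at ONE level: some open compact `K` with `Hom_E(A_K, A_μ)_ℚ ≠ 0`. [cite: Liu2021, Thm. 4.18 (1)] -/
theorem exists_level_homK_ne_zero (h : Liu2021.Thm418AsPrinted D) (Dμ : D.Obj) (χ : D.Chi)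
    (hω : ∀ i : D.AdmIndex, ∃ K₁ : Subgroup D.G, IsOpenCompact K₁ ∧
      ∃ v : D.omegaAt i, v ≠ 0 ∧ ∀ k ∈ K₁, D.rhoAt i k v = v) :
    ∃ K : Subgroup D.G, IsOpenCompact K ∧ ∃ φ : D.HomK K Dμ, φ ≠ 0 := by
  obtain ⟨K₀, hK₀, hK⟩ := exists_homK_ne_zero_of_smooth h Dμ χ hω
  exact ⟨K₀, hK₀, hK K₀ hK₀ le_rfl⟩

/-- **Below a prescribed level.**  The same with the level forced under a given open compact `K'` (e.g. a neat level, so that the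
consumer's `X_K` has smooth components): some open compact `K ≤ K'` has `Hom_E(A_K, A_μ)_ℚ ≠ 0` (take `K := K₀ ∩ K'`).
[cite: Liu2021, Thm. 4.18 (1)] -/
theorem exists_homK_ne_zero_le (h : Liu2021.Thm418AsPrinted D) (Dμ : D.Obj) (χ : D.Chi)
    (hω : ∀ i : D.AdmIndex, ∃ K₁ : Subgroup D.G, IsOpenCompact K₁ ∧
      ∃ v : D.omegaAt i, v ≠ 0 ∧ ∀ k ∈ K₁, D.rhoAt i k v = v)
    {K' : Subgroup D.G} (hK' : IsOpenCompact K') :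
    ∃ K : Subgroup D.G, IsOpenCompact K ∧ K ≤ K' ∧ ∃ φ : D.HomK K Dμ, φ ≠ 0 := by
  obtain ⟨K₀, hK₀, hK⟩ := exists_homK_ne_zero_of_smooth h Dμ χ hω
  have hKK : IsOpenCompact (K₀ ⊓ K') := by
    refine ⟨?_, ?_⟩ <;> rw [Subgroup.coe_inf]
    · exact hK₀.1.inter hK'.1
    · exact hK₀.2.inter_right (Subgroup.isClosed_of_isOpen K' hK'.1)
  exact ⟨K₀ ⊓ K', hKK, inf_le_right, hK _ hKK inf_le_left⟩

/-! ## Consistency certificate (tribunal item T5): the binder sets above are jointly inhabited -/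

/-- **T5 consistency certificate — the SCALAR DATUM.**  Over every CM extension `E/F` as in l. 1878 there is a datum
`D : Thm418Data F E` at which ALL hypotheses used in this file hold simultaneously: `Thm418AsPrinted D`, `D.Obj` and `D.Chi`
inhabited, and every summand `ω_i` has a non-zero vector fixed by an open compact subgroup.  The datum: `𝔾 := PUnit` (so `⊤`
is open compact), `Eps := Chi := Obj := PUnit`, `μ` a weight-one conjugate-symplectic character (tree
`IdeleClassGroup.exists_isConjugateSymplectic_hasCMType`), `ω := ℂ` with the trivial action, `Ω(μ) := M_μ`, `Φ : ℂ ⊗_{M_μ} M_μ ≃ ℂ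
≃ ⨁_{one index} ℂ`, `Hom_E(A_K, A_μ)_ℚ := M_μ` with `res := id`.  Hence NO contradiction is derivable from the binder sets of
`exists_mem_invariants_ne_zero` / `exists_homK_ne_zero` / `exists_homK_ne_zero_of_smooth` / `exists_level_homK_ne_zero` /
`exists_homK_ne_zero_le` (each is a sub-family of this one, instantiated at `D`).  A statement about hypothesis shapes, not about
Liu's objects; our bookkeeping. [cite: Liu2021, Thm. 4.18] -/
theorem scalarDatum_consistent (F E : Type) [Field F] [NumberField F] [IsTotallyReal F] [Field E] [NumberField E]
    [Algebra F E] [IsTotallyComplex E] [Algebra.IsQuadraticExtension F E] :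
    ∃ D : Thm418Data F E, Liu2021.Thm418AsPrinted D ∧ Nonempty D.Obj ∧ Nonempty D.Chi ∧
      ∀ i : D.AdmIndex, ∃ K₁ : Subgroup D.G, IsOpenCompact K₁ ∧
        ∃ v : D.omegaAt i, v ≠ 0 ∧ ∀ k ∈ K₁, D.rhoAt i k v = v := by
  classical
  letI : IsCMField E := isCMField F E
  obtain ⟨μ, hμ, hw, -⟩ := IdeleClassGroup.exists_isConjugateSymplectic_hasCMType (L := E)
    (IdeleClassGroup.cmTypeOf E (fun _ => -1) (by simp))
  let D : Thm418Data F E :=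
    { n := 2, two_le_n := le_rfl, 𝕍 := PUnit, G := PUnit, Eps := PUnit, epsOf := fun _ => PUnit.unit, Chi := PUnit,
      μ := μ, isConjugateSymplectic := hμ, hasWeight_one := hw, Obj := PUnit,
      omega := fun _ _ => ℂ, rho := fun _ _ => 1, Ω := fieldOfValues E μ, rhoΩ := 1,
      HomK := fun _ _ => fieldOfValues E μ, res := fun _ _ => AddMonoidHom.id _ }
  obtain ⟨i₀⟩ : Nonempty D.AdmIndex := nonempty_admIndex (D := D) PUnit.unit
  haveI : Subsingleton D.AdmIndex := ⟨fun a b => Subtype.ext (Subsingleton.elim (α := PUnit × PUnit) _ _)⟩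
  have htop : IsOpenCompact (⊤ : Subgroup D.G) := by
    refine ⟨?_, ?_⟩ <;> rw [Subgroup.coe_top]
    · exact isOpen_univ
    · exact isCompact_univ
  refine ⟨D, ?_, ⟨PUnit.unit⟩, ⟨PUnit.unit⟩, fun i => ⟨⊤, htop, (1 : ℂ), one_ne_zero, fun k _ => rfl⟩⟩
  -- `Thm418AsPrinted D` at the scalar datum
  let e₁ : ℂ ⊗[fieldOfValues E μ] (fieldOfValues E μ) ≃ₗ[ℂ] ℂ :=
    TensorProduct.AlgebraTensorModule.rid (fieldOfValues E μ) ℂ ℂ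
  let e₂ : ℂ ≃ₗ[ℂ] (⨁ _ : D.AdmIndex, ℂ) :=
    LinearEquiv.ofLinear (DirectSum.lof ℂ D.AdmIndex (fun _ => ℂ) i₀) (DirectSum.component ℂ D.AdmIndex (fun _ => ℂ) i₀)
      (LinearMap.ext fun y => by
        show DirectSum.lof ℂ D.AdmIndex (fun _ => ℂ) i₀ (DirectSum.component ℂ D.AdmIndex (fun _ => ℂ) i₀ y) = y
        refine DFinsupp.ext fun j => ?_
        obtain rfl : j = i₀ := Subsingleton.elim _ _
        exact DirectSum.lof_apply ℂ (M := fun _ => ℂ) j _)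
      (LinearMap.ext fun c => by
        show DirectSum.component ℂ D.AdmIndex (fun _ => ℂ) i₀ (DirectSum.lof ℂ D.AdmIndex (fun _ => ℂ) i₀ c) = c
        exact DirectSum.component.lof_self ℂ (M := fun _ => ℂ) i₀ c)
  refine ⟨e₁.trans e₂, ?_, ?_, ?_, ?_⟩
  · -- equivariance: both actions are trivial
    intro g x i
    have h1 : (D.rhoΩ g).baseChange ℂ x = x := by
      show ((1 : Representation (fieldOfValues E μ) PUnit (fieldOfValues E μ)) g).baseChange ℂ x = x
      rw [MonoidHom.one_apply, LinearMap.baseChange_one]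
      rfl
    rw [h1]
    rfl
  · -- (1): every level works; `res = id` is injective with image everything = the invariants of the trivial action
    intro Dμ
    refine ⟨⊤, htop, fun K _ _ => ⟨fun a b h => h, ?_⟩⟩
    ext x
    exact ⟨fun _ k _ => rfl, fun _ => ⟨x, rfl⟩⟩
  · -- (2): one index
    exact fun i j _ => Subsingleton.elim i j
  · -- (3): one `ε`
    intro ε _ σ x _ i hne
    exact absurd (Subsingleton.elim _ _) hne

end Thm418Data

end Literature.NumberTheory.Automorphic.Liu2021

end
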